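import Summits.BirchSwinnertonDyer.BirchSwinnertonDyer.Theorems.ErratumRoadFiveNonSurjCornerKolyZUnitIndex
import Literature.NumberTheory.EllipticCurves.HeegnerPointsOfConductorOneRationalityProofs
import Literature.NumberTheory.EllipticCurves.HeegnerPointsOfConductorOneGaloisConjProofs
import HarnessLib

/-!
# Route `ErratumRoadFive` (rung K2, `p ≥ 5`), crux child `NonSurjCornerKolyZ` (item stmt-BirchSwinnertonDyer-19946 =
# `stub_kolyZ57` of the registered hybrid line `Cruxes/NonSurjCorner/Lines/hybrid.lean` of 19065): the certificate branch
# Zₚᶜ ON THE SHALLOW LOCUS — a conductor-1 certificate at depth `t = ord_p ∏ c_ℓ` at every corner frame whose bottom Heegner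
# point `y_K` is NOT `p^{t+1}`-divisible in `E(K)` — and the reduction of the child to its DEEP locus
# (cell `bsd-stepL`, seat `bsd-stepL-corner-p1` g14; `--supports stmt-BirchSwinnertonDyer-19946`)

WHAT. The child `NonSurjCornerKolyZ` asks, at every (T4′) corner frame `(E, p, K, Dt, β, ι)` (`p ∈ {5,7}`, `ρ̄_{E,p}` not
onto, `(E,p) ∈` X11b, `p ∣ ord_p Δ_min`, no (ram) witness; `K` imaginary quadratic Heegner for `N` and `p`, `|d_K| > 4`,
`β² ≡ d_K (mod 4N)`, `p ∤ Dt.c`), for SOME depth `M ≤ t := ord_p ∏_ℓ c_ℓ(E/ℚ)` carrying `CertificateAt Dt β ι p M` (a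
square-free `n ∈ S_r(M+1)` and a Kolyvagin–Heegner datum of conductor `n` with `P_n ∉ p^{M+1} E(K[n])`), i.e. McCallum's
`M_∞ ≤ t`. The seat's g7 file (`…KolyZUnitIndex`, p498342) closed the UNIT-INDEX locus (`y_K ∉ p E(K)`, depth `M = 0`).
This file closes the whole SHALLOW locus — the frames with `y_K ∉ p^{t+1} E(K)` — with the conductor-`1` certificate at
depth `M = t` itself: `n = 1 ∈ S_0(t+1)` vacuously, and `P_1 ∉ p^{t+1} E(K[1]) ⟺ y_K ∉ p^{t+1} E(K)` because `E(K[1])`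
has no `p`-power torsion on the irreducible cell (Gross 1991 Lemma 4.3 WITHOUT surjectivity, x11b3-p4's
`torsionBy_pow_ringClassField_eq_bot_of_hasIrreducibleModPGaloisRep`; descent = McCallum Lemma 5.1,
`Koly.pDiv_one_iff_exists_zsmul_eq`). By Gross–Zagier + BSD for `E/K` (`[E(K) : ℤ y_K] = c·∏_{ℓ∣N} c_ℓ·#Ш(E/K)^{1/2}`
up to `p`-units) the shallow locus is the frames with `Ш(E/K)[p] = 0` (and `p ∤ c`): the GENERIC corner frame. What is
left of 19946 after this file is its DEEP locus — the frames at which the bottom Heegner point lies in `p^{t+1} E(K)`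
(predicted: `Ш(E/K)[p] ≠ 0`), where a certificate must come from a DERIVED class `P_n`, `n ≠ 1`: Kolyvagin's conjecture
proper, in its refined form `M_∞ ≤ Σ_ℓ ord_p c_ℓ`, at a non-surjective irreducible image and `p ∥ N`. Print (2026-08):
Burungale–Castella–Grossi–Skinner, Camb. J. Math. 14 (2026) Thm. 2 proves `M_∞ = Σ ord_p c_ℓ` for `ρ̄` ONTO at GOOD
ordinary `p > 3` (their Thm. 1, `M_∞ < ∞` under (irr) only, does not bound the depth); Sweeting arXiv:2012.11771v3 Thm. A
(no surjectivity) needs `p ∤ N`; Castella arXiv:2409.01360 Thm. 1.3 (`p ∥ N`) needs a (ram) witness — none reaches the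
corner's deep locus (nothing of theirs is used or asserted here).

* §1 `Koly.certificateAt_of_not_pDiv_one` — `P_1 ∉ p^{M+1} E(K[1])` IS a certificate `CertificateAt Dt β ι p M` at ANY
  depth `M` (`1 ∈ S_0(M+1)` vacuously); g7's `certificateAt_zero_of_not_pDiv_one` is the case `M = 0`.
* §2 `Koly.not_pDiv_one_of_not_exists_pow_smul_eq` — on the irreducible cell (`p` odd, `E[p]` irreducible, `p` split in
  `K`): `y ∉ p^s E(K)` and `y ↦ P_1` give `P_1 ∉ p^s E(K[1])`, every `s`.
* §3 **`Theorems.nonSurjCornerKolyZ_of_bottom_not_pow_divisible`** — the child's conclusion at every corner frame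
  carrying the ONE extra hypothesis «every conductor-1 datum's bottom point, read in `E(K)`, is not `p^{t+1}`-divisible»,
  with the witness depth `M = t`; modulo Darmon 2004 Thm. 3.6 (`hD36`) and Shimura reciprocity at conductor 1 (`hrec`),
  conjuncts of the route's support bundle `KatoTwinFactsFiveAn` (19949) exactly as in p498342.
* §4 **`Theorems.nonSurjCornerKolyZ_of_deep`** — THE REDUCTION: `NonSurjCornerKolyZ` (the child, BY NAME) follows from
  its restriction to the DEEP frames (extra binder: some conductor-1 datum's bottom point IS `p^{t+1}`-divisible in
  `E(K)`), modulo `hD36`, `hrec`. The deep restriction is displayed verbatim as the hypothesis `hdeep` — the honest open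
  core of `stub_kolyZ57`, offered to the planner as the one open stub of a reshaped `Lines/birth.lean` of 19946.
* §5 (appended) **the primed forms `nonSurjCornerKolyZ_of_bottom_not_pow_divisible'`, `nonSurjCornerKolyZ_of_deep'`** — the same with
  `hD36`, `hrec` DISCHARGED by the tree theorems `phi_heegnerTau_mem_singularModuliField_holds` and
  `heegnerPointOfConductor_one_galoisConj_holds`: the child follows from its deep locus ALONE (no named fact left on this side).

HONEST FRAMING: six theorems (no definition, no named fact minted, no `sorry`, axioms the standard trio); CONDITIONAL
on the displayed per-frame hypotheses (`hD36`, `hrec` only in §3–§4; discharged in §5); nothing is asserted about any curve; item 19946 does NOT close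
(its deep locus is open mathematics); 19065 is not advanced beyond bookkeeping; BSD is proved for no curve; no census
word moves (T7).

References: [McCallumLMS1991] §5 Lemma 5.1 (p. 303), definitions of `S_r(M)`, `M_r`, `M_∞`, Cor. 5.6 (p. 310);
[GrossLMS1991] §4 Lemma 4.3, (4.1); [Darmon2004] Thm. 3.6; [GrossZagier1986] I (6.5) with V (2.2) (the index ∕ Ш reading,
prose only); [BurungaleEtAl2026] Thm. 1, Thm. 2 (print status of the deep locus, prose only); [Sweeting2020] v3 Thm. A;
[Castella2024] Thm. 1.3; tree: `Theorems/ErratumRoadFiveNonSurjCornerKolyZUnitIndex.lean` (p498342),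
`X11b/Three/KolyvaginNonvanishing.lean` (`CertificateAt`), `X11b/Three/KolyvaginLine.lean` (`PDiv`, McCallum 5.1),
`X11b/RingClassFieldNoTorsionOfIrreducible.lean`, `Theorems/ErratumRoadFiveNonSurjCornerBranchesDefs.lean` (p486726).
-/

set_option autoImplicit false
set_option linter.dupNamespace false

noncomputable section

open scoped Classical NumberField

namespace Summit.BirchSwinnertonDyer.Rank1Residual.X11b.Three.Koly

open WeierstrassCurve NumberField IsDedekindDomain
  Literature.NumberTheory.EllipticCurves Literature.NumberTheory.EllipticCurves.ModularForms
  Literature.NumberTheory.EllipticCurves.Rank1Residual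
  Summit.BirchSwinnertonDyer.Rank1Residual Summit.BirchSwinnertonDyer.Rank1Residual.X11b

variable {N : ℕ} [NeZero N] {W : WeierstrassCurve ℚ} {K : Type} [Field K] [NumberField K]
  {Dt : ModularParametrizationData W N} {β : ℤ} {ι : K →+* ℂ}

/-! ### §1 `P_1 ∉ p^{M+1} E(K[1])` is a conductor-1 certificate at depth `M` -/

/-- **A conductor-`1` datum with `P_1 ∉ p^{M+1} E(K[1])` is a certificate `CertificateAt Dt β ι p M`, at every depth `M`**:
`n = 1` is square-free with no prime factor, so `1 ∈ S_0(M+1)` vacuously (`MemS N W K p 0 (M+1) 1`: the index condition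
`M+1 ≤ M(ℓ)` quantifies over the empty set of prime factors), and `¬ PDiv d₁ p (M+1)` is the non-divisibility clause —
McCallum's `M_0 ≤ M`, whence `M_∞ ≤ M_0 ≤ M`. [cite: McCallumLMS1991, §5 (p. 303), definitions of S_r(M), M_r, M_∞] -/
theorem certificateAt_of_not_pDiv_one [W.IsGloballyMinimal] (d₁ : KolyvaginHeegnerData Dt β ι 1) {p M : ℕ}
    (h : ¬ PDiv d₁ p (M + 1)) : CertificateAt Dt β ι p M :=
  ⟨1, 0, d₁, ⟨squarefree_one, by simp, by simp⟩, h⟩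

/-! ### §2 Descent of `p^s`-divisibility from `E(K[1])` to `E(K)` on the irreducible cell -/

/-- **`y ∉ p^s E(K) ⟹ P_1 ∉ p^s E(K[1])`, every exponent `s`, WITHOUT surjectivity.** For `E/ℚ` with `E[p]`
irreducible, `p` odd, `K` imaginary quadratic in which `p` splits (`SatisfiesHeegnerHypothesis p K`, so `p` is unramified
in `K`), a conductor-`1` datum `d₁` and `y ∈ E(K)` mapping to `P_1 = d₁.derivedPoint`: `E(K[1])` has no `p^s`-torsion
(Gross 1991 Lemma 4.3 on the irreducible cell, `torsionBy_pow_ringClassField_eq_bot_of_hasIrreducibleModPGaloisRep`, Weil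
pairing from the tree theorem `exists_weilPairing_holds`), so `p^s ∣ P_1` in `E(K[1])` iff `p^s ∣ y` in `E(K)`
(`pDiv_one_iff_exists_zsmul_eq`, McCallum Lemma 5.1). g7's `not_pDiv_one_of_not_exists_smul_eq` is `s = 1`.
[cite: McCallumLMS1991, §5 Lemma 5.1 (p. 303) and its proof (p. 304)] [cite: GrossLMS1991, §4 Lemma 4.3] -/
theorem not_pDiv_one_of_not_exists_pow_smul_eq [W.IsElliptic] (hK : IsImaginaryQuadratic K)
    {p : ℕ} (hp : p.Prime) (hp2 : p ≠ 2) (hirr : W.HasIrreducibleModPGaloisRep p)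
    (hHp : SatisfiesHeegnerHypothesis p K)
    (d₁ : KolyvaginHeegnerData Dt β ι 1) (y : (W.baseChange K).toAffine.Point)
    (hy : WeierstrassCurve.Affine.Point.map (W' := W) (algebraMap K (ringClassField K ι 1)).toRatAlgHom y =
      d₁.derivedPoint)
    (s : ℕ) (hndiv : ¬ ∃ Q : (W.baseChange K).toAffine.Point, ((p ^ s : ℕ) : ℤ) • Q = y) : ¬ PDiv d₁ p s := by
  -- `E(K[1])[p^s] = 0` on the irreducible cell
  have hp1 : ¬ p ∣ 1 := fun h => hp.one_lt.ne' (Nat.dvd_one.mp h)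
  have hbot := NoTorsionIrr.torsionBy_pow_ringClassField_eq_bot_of_hasIrreducibleModPGaloisRep W hK ι one_ne_zero
    hp hp2 hirr (WeierstrassCurve.exists_weilPairing_holds W p)
    (isUnramifiedIn_of_satisfiesHeegnerHypothesis_of_dvd hK hHp hp dvd_rfl) hp1 s
  have htor : ∀ R : (W.baseChange (ringClassField K ι 1)).toAffine.Point, ((p ^ s : ℕ) : ℤ) • R = 0 → R = 0 := by
    intro R hR
    have hmem : R ∈ AddSubgroup.torsionBy (W.baseChange (ringClassField K ι 1)).toAffine.Point ((p ^ s : ℕ) : ℤ) :=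
      (Submodule.mem_torsionBy_iff _ R).mpr hR
    rw [hbot] at hmem
    exact hmem
  intro hdiv
  exact hndiv ((pDiv_one_iff_exists_zsmul_eq hK d₁ y hy p s htor).mp hdiv)

end Summit.BirchSwinnertonDyer.Rank1Residual.X11b.Three.Koly

namespace Summit.BirchSwinnertonDyer.BirchSwinnertonDyer.Theorems

open WeierstrassCurve NumberField IsDedekindDomain Field
  Literature.NumberTheory.EllipticCurves Literature.NumberTheory.EllipticCurves.ModularForms
  Literature.NumberTheory.EllipticCurves.Rank1Residual
  Summit.BirchSwinnertonDyer.Rank1Residual Summit.BirchSwinnertonDyer.Rank1Residual.X11b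
  Summit.BirchSwinnertonDyer.Rank1Residual.X11b.Three.Koly

/-! ### §3 Zₚᶜ on the shallow locus (depth `t = ord_p ∏ c_ℓ`) -/

/-- **The certificate branch `NonSurjCornerKolyZ` (item 19946 = `stub_kolyZ57`) ON THE SHALLOW LOCUS.** For every (T4′)
corner frame — `W/ℚ` globally minimal with `(E,p) ∈` X11b, `ρ̄_{E,p}` not onto, `p ∈ {5,7}`, `p ∣ ord_p Δ_min`, no
(ram) witness, `N = N_E`, `K` imaginary quadratic with `|d_K| > 4`, Heegner for `N` and for `p`, `β² ≡ d_K (mod 4N)`,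
`p ∤ Dt.c` — carrying the extra hypothesis «for every conductor-1 Kolyvagin–Heegner datum `d₁` on `(Dt, β, ι)` and every
`y ∈ E(K)` mapping to `P_1`, `y ∉ p^{t+1} E(K)», `t = ord_p ∏_ℓ c_ℓ(E/ℚ)` (the frame's Heegner point is at most
`p^t`-divisible), there is a certificate at depth `M = t ≤ t`: the datum `d₁` exists (Darmon 2004 Thm. 3.6, `hD36`), its
bottom point descends to a Heegner point `y ∈ E(K)` (Shimura reciprocity at conductor 1, `hrec`), the hypothesis makes
`y ∉ p^{t+1} E(K)`, §2 lifts that to `P_1 ∉ p^{t+1} E(K[1])`, §1 packages it. Most frame binders are unused (only (irr),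
`p` odd, the Heegner hypotheses and `β` act); they are displayed so that the statement is the child's text plus ONE
hypothesis. Reading (prose, not used): by Gross–Zagier + BSD the hypothesis says `Ш(E/K)[p] = 0` and `p ∤ c_Manin` — the
generic frame; g7's unit-index theorem (p498342) is the sub-case `t = 0` of the hypothesis with exponent `1`. CONDITIONAL
on `hD36`, `hrec` and that hypothesis; nothing booked; 19946 stays OPEN on the deep locus (§4).
[cite: McCallumLMS1991, §5 Lemma 5.1 (p. 303), Cor. 5.6 (p. 310)] [cite: GrossLMS1991, §4 Lemma 4.3 and (4.1)]
[cite: Darmon2004, Thm. 3.6] -/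
theorem nonSurjCornerKolyZ_of_bottom_not_pow_divisible
    (hD36 : ∀ (N : ℕ) [NeZero N] (W : WeierstrassCurve ℚ) (K : Type) [Field K] [NumberField K],
      phi_heegnerTau_mem_singularModuliField N W K)
    (hrec : ∀ (N : ℕ) [NeZero N] (W : WeierstrassCurve ℚ) (K : Type) [Field K] [NumberField K],
      heegnerPointOfConductor_one_galoisConj N W K) :
    ∀ (W : WeierstrassCurve ℚ) [W.IsElliptic] [W.IsGloballyMinimal] (p : ℕ) [Fact p.Prime]
      (N : ℕ) [NeZero N] (K : Type) [Field K] [NumberField K]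
      (Dt : ModularParametrizationData W N) (β : ℤ) (ι : K →+* ℂ),
      ClassX11b W p → ¬ Surj W p → (p = 5 ∨ p = 7) → p ∣ padicValInt p W.minimalDiscriminantInt →
      ¬ Ram W p → W.conductorNorm ℤ = N → IsImaginaryQuadratic K →
      4 < (NumberField.discr K).natAbs → SatisfiesHeegnerHypothesis N K →
      SatisfiesHeegnerHypothesis p K → (4 * (N : ℤ)) ∣ β ^ 2 - NumberField.discr K → ¬ (p : ℤ) ∣ Dt.c →
      (∀ (d₁ : KolyvaginHeegnerData Dt β ι 1) (y : (W.baseChange K).toAffine.Point),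
        WeierstrassCurve.Affine.Point.map (W' := W) (algebraMap K (ringClassField K ι 1)).toRatAlgHom y =
          d₁.derivedPoint →
        ¬ ∃ Q : (W.baseChange K).toAffine.Point, ((p ^ (padicValNat p W.tamagawaProduct + 1) : ℕ) : ℤ) • Q = y) →
      ∃ M : ℕ, M ≤ padicValNat p W.tamagawaProduct ∧ CertificateAt Dt β ι p M := by
  intro W _ _ p _ N _ K _ _ Dt β ι hX _ _ _ _ _ hK _ hHN hHp hβ _ hshallow
  obtain ⟨_, hp2, _, hirr⟩ := id hX
  have hp : p.Prime := Fact.out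
  -- the conductor-1 datum (Darmon 2004 Thm. 3.6) and its bottom point in `E(K)` (Shimura reciprocity)
  obtain ⟨d₁⟩ := exists_kolyvaginHeegnerData_one (hD36 N W K) hK Dt β ι hβ
  obtain ⟨y, -, hy⟩ := heegnerSystem_exists_isHeegnerPoint_map_eq_derivedPoint_one (hrec N W K) hK hHN d₁
  exact ⟨padicValNat p W.tamagawaProduct, le_rfl, certificateAt_of_not_pDiv_one d₁
    (not_pDiv_one_of_not_exists_pow_smul_eq hK hp hp2 hirr hHp d₁ y hy _ (hshallow d₁ y hy))⟩

/-! ### §4 The reduction of the child to its deep locus -/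

/-- **`NonSurjCornerKolyZ` (item 19946, BY NAME) FROM ITS DEEP LOCUS.** If the child's conclusion
`∃ M ≤ ord_p ∏c, CertificateAt Dt β ι p M` holds at every corner frame that carries, IN ADDITION, a conductor-1
Kolyvagin–Heegner datum `d₁` and a point `y ∈ E(K)` over `P_1` with `y ∈ p^{t+1} E(K)` (`t = ord_p ∏_ℓ c_ℓ(E/ℚ)`; the
DEEP frames — predicted by Gross–Zagier + BSD to be exactly the frames with `Ш(E/K)[p] ≠ 0` or `p ∣ c_Manin`), then the
child holds at EVERY corner frame: off the deep locus §3 supplies the conductor-1 certificate at depth `t`. The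
hypothesis `hdeep` is the child's text with ONE more binder, displayed verbatim — the honest open core of `stub_kolyZ57`
(Kolyvagin's conjecture proper, refined form `M_∞ ≤ Σ_ℓ ord_p c_ℓ`, at a non-surjective irreducible image and `p ∥ N`:
a DERIVED class `P_n`, `n ≠ 1` a product of Kolyvagin primes of index `≥ M+1`, must fail to be `p^{M+1}`-divisible).
CONDITIONAL on `hD36`, `hrec`, `hdeep`; nothing booked; no print reaches `hdeep` (module docstring).
[cite: McCallumLMS1991, §5 (p. 303), Cor. 5.6 (p. 310)] [cite: Darmon2004, Thm. 3.6] -/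
theorem nonSurjCornerKolyZ_of_deep
    (hD36 : ∀ (N : ℕ) [NeZero N] (W : WeierstrassCurve ℚ) (K : Type) [Field K] [NumberField K],
      phi_heegnerTau_mem_singularModuliField N W K)
    (hrec : ∀ (N : ℕ) [NeZero N] (W : WeierstrassCurve ℚ) (K : Type) [Field K] [NumberField K],
      heegnerPointOfConductor_one_galoisConj N W K)
    (hdeep : ∀ (W : WeierstrassCurve ℚ) [W.IsElliptic] [W.IsGloballyMinimal] (p : ℕ) [Fact p.Prime]
      (N : ℕ) [NeZero N] (K : Type) [Field K] [NumberField K]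
      (Dt : ModularParametrizationData W N) (β : ℤ) (ι : K →+* ℂ),
      ClassX11b W p → ¬ Surj W p → (p = 5 ∨ p = 7) → p ∣ padicValInt p W.minimalDiscriminantInt →
      ¬ Ram W p → W.conductorNorm ℤ = N → IsImaginaryQuadratic K →
      4 < (NumberField.discr K).natAbs → SatisfiesHeegnerHypothesis N K →
      SatisfiesHeegnerHypothesis p K → (4 * (N : ℤ)) ∣ β ^ 2 - NumberField.discr K → ¬ (p : ℤ) ∣ Dt.c →
      (∃ (d₁ : KolyvaginHeegnerData Dt β ι 1) (y : (W.baseChange K).toAffine.Point),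
        WeierstrassCurve.Affine.Point.map (W' := W) (algebraMap K (ringClassField K ι 1)).toRatAlgHom y =
          d₁.derivedPoint ∧
        ∃ Q : (W.baseChange K).toAffine.Point, ((p ^ (padicValNat p W.tamagawaProduct + 1) : ℕ) : ℤ) • Q = y) →
      ∃ M : ℕ, M ≤ padicValNat p W.tamagawaProduct ∧ CertificateAt Dt β ι p M) :
    NonSurjCornerKolyZ := by
  intro W _ _ p _ N _ K _ _ Dt β ι hX hS hp57 hΔ hR hN hK hd hHN hHp hβ hc
  by_cases h : ∃ (d₁ : KolyvaginHeegnerData Dt β ι 1) (y : (W.baseChange K).toAffine.Point),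
      WeierstrassCurve.Affine.Point.map (W' := W) (algebraMap K (ringClassField K ι 1)).toRatAlgHom y =
        d₁.derivedPoint ∧
      ∃ Q : (W.baseChange K).toAffine.Point, ((p ^ (padicValNat p W.tamagawaProduct + 1) : ℕ) : ℤ) • Q = y
  · exact hdeep W p N K Dt β ι hX hS hp57 hΔ hR hN hK hd hHN hHp hβ hc h
  · push Not at h
    exact nonSurjCornerKolyZ_of_bottom_not_pow_divisible hD36 hrec W p N K Dt β ι hX hS hp57 hΔ hR hN hK hd hHN hHp
      hβ hc (fun d₁ y hy hQ => by obtain ⟨Q, hQ⟩ := hQ; exact h d₁ y hy Q hQ)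

/-! ### §5 (appended, g14) The named inputs `hD36`, `hrec` are PROVED in the tree: unconditional forms -/

/-- **Zₚᶜ on the shallow locus, UNCONDITIONALLY.** §3 with its two named print inputs DISCHARGED by tree theorems:
Darmon 2004 Thm. 3.6 = `phi_heegnerTau_mem_singularModuliField_holds` (`HeegnerPointsOfConductorOneRationalityProofs`) and
Shimura reciprocity at conductor 1 = `heegnerPointOfConductor_one_galoisConj_holds` (`HeegnerPointsOfConductorOneGaloisConjProofs`).
So at every (T4′) corner frame whose conductor-1 bottom Heegner points satisfy `y ∉ p^{t+1} E(K)` the child's conclusion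
`∃ M ≤ ord_p ∏c, CertificateAt Dt β ι p M` HOLDS with no named-fact hypothesis at all (g7's unit-index theorem p498342 likewise
becomes unconditional: exponent `1 ≤ t+1`). Nothing booked: the hypothesis is per frame. [cite: Darmon2004, Thm. 3.6 and Thm. 3.7]
[cite: McCallumLMS1991, §5 Lemma 5.1 (p. 303)] -/
theorem nonSurjCornerKolyZ_of_bottom_not_pow_divisible' :
    ∀ (W : WeierstrassCurve ℚ) [W.IsElliptic] [W.IsGloballyMinimal] (p : ℕ) [Fact p.Prime]
      (N : ℕ) [NeZero N] (K : Type) [Field K] [NumberField K]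
      (Dt : ModularParametrizationData W N) (β : ℤ) (ι : K →+* ℂ),
      ClassX11b W p → ¬ Surj W p → (p = 5 ∨ p = 7) → p ∣ padicValInt p W.minimalDiscriminantInt →
      ¬ Ram W p → W.conductorNorm ℤ = N → IsImaginaryQuadratic K →
      4 < (NumberField.discr K).natAbs → SatisfiesHeegnerHypothesis N K →
      SatisfiesHeegnerHypothesis p K → (4 * (N : ℤ)) ∣ β ^ 2 - NumberField.discr K → ¬ (p : ℤ) ∣ Dt.c →
      (∀ (d₁ : KolyvaginHeegnerData Dt β ι 1) (y : (W.baseChange K).toAffine.Point),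
        WeierstrassCurve.Affine.Point.map (W' := W) (algebraMap K (ringClassField K ι 1)).toRatAlgHom y =
          d₁.derivedPoint →
        ¬ ∃ Q : (W.baseChange K).toAffine.Point, ((p ^ (padicValNat p W.tamagawaProduct + 1) : ℕ) : ℤ) • Q = y) →
      ∃ M : ℕ, M ≤ padicValNat p W.tamagawaProduct ∧ CertificateAt Dt β ι p M :=
  nonSurjCornerKolyZ_of_bottom_not_pow_divisible (fun N _ W K _ _ => phi_heegnerTau_mem_singularModuliField_holds N W K)
    (fun N _ W K _ _ => heegnerPointOfConductor_one_galoisConj_holds N W K)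

/-- **`NonSurjCornerKolyZ` (item 19946 = `stub_kolyZ57`, BY NAME) FROM ITS DEEP LOCUS ALONE.** §4 with `hD36`, `hrec` discharged by the
tree theorems above: the child follows from its own text restricted to the DEEP frames (one extra binder: a conductor-1 datum `d₁` and
`y ∈ E(K)` over `P_1` with `y ∈ p^{t+1} E(K)`, `t = ord_p ∏_ℓ c_ℓ(E/ℚ)`), and from NOTHING else. This is the exact open content of the
stub: Kolyvagin's conjecture proper (refined form `M_∞ ≤ Σ_ℓ ord_p c_ℓ`; a derived class `P_n`, `n ≠ 1`, must certify) at a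
non-surjective irreducible image and `p ∥ N`, on the frames predicted (GZ + BSD) to carry `Ш(E/K)[p] ≠ 0` or `p ∣ c_Manin`. CONDITIONAL
on `hdeep` only; nothing booked. [cite: McCallumLMS1991, §5 (p. 303), Cor. 5.6 (p. 310)] [cite: Darmon2004, Thm. 3.6 and Thm. 3.7] -/
theorem nonSurjCornerKolyZ_of_deep'
    (hdeep : ∀ (W : WeierstrassCurve ℚ) [W.IsElliptic] [W.IsGloballyMinimal] (p : ℕ) [Fact p.Prime]
      (N : ℕ) [NeZero N] (K : Type) [Field K] [NumberField K]
      (Dt : ModularParametrizationData W N) (β : ℤ) (ι : K →+* ℂ),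
      ClassX11b W p → ¬ Surj W p → (p = 5 ∨ p = 7) → p ∣ padicValInt p W.minimalDiscriminantInt →
      ¬ Ram W p → W.conductorNorm ℤ = N → IsImaginaryQuadratic K →
      4 < (NumberField.discr K).natAbs → SatisfiesHeegnerHypothesis N K →
      SatisfiesHeegnerHypothesis p K → (4 * (N : ℤ)) ∣ β ^ 2 - NumberField.discr K → ¬ (p : ℤ) ∣ Dt.c →
      (∃ (d₁ : KolyvaginHeegnerData Dt β ι 1) (y : (W.baseChange K).toAffine.Point),
        WeierstrassCurve.Affine.Point.map (W' := W) (algebraMap K (ringClassField K ι 1)).toRatAlgHom y =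
          d₁.derivedPoint ∧
        ∃ Q : (W.baseChange K).toAffine.Point, ((p ^ (padicValNat p W.tamagawaProduct + 1) : ℕ) : ℤ) • Q = y) →
      ∃ M : ℕ, M ≤ padicValNat p W.tamagawaProduct ∧ CertificateAt Dt β ι p M) :
    NonSurjCornerKolyZ :=
  nonSurjCornerKolyZ_of_deep (fun N _ W K _ _ => phi_heegnerTau_mem_singularModuliField_holds N W K)
    (fun N _ W K _ _ => heegnerPointOfConductor_one_galoisConj_holds N W K) hdeep

end Summit.BirchSwinnertonDyer.BirchSwinnertonDyer.Theorems

end
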